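import Literature.AlgebraicGeometry.HodgeTheory.SignSymmetricTransvectionMonodromy
import Literature.AlgebraicGeometry.HodgeTheory.TensorStabilizerZariskiClosed
import HarnessLib

/-!
# Commutators of the sign-symmetric centraliser lie in the Hodge group
# (the algebraic skeleton of crux K1 `VeryGeneralSignCommutatorsInHg`, assembled)

Family `hodge`, layer `Literature/AlgebraicGeometry/HodgeTheory`. One THEOREM gluing
`SignSymmetricTransvectionMonodromy.mem_glIdentityComponent_of_signSymmetric` ("`Mon⁰ ⊇ Sp(V₊) × Sp(V₋)`"
on `ℚ`-points: every `σ`-commuting `B`-isometry lies in the identity component `glIdentityComponent Γ`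
of a group `Γ` generated — up to finite index — by transvections along fixed centres and by commuting
pairs) with `TensorStabilizerZariskiClosed.commutator_mem_hodgeGroup_of_subset_mumfordTateGroup`
(commutators of a subset of `MT(H)(ℚ)` lie in `Hg(H)(ℚ)` for polarizable `H` of odd weight —
`Motives/MumfordTateCommutatorsHodgeGroup`). No definition, no named fact (net debt `0`).

**Theorem** (`commutator_mem_hodgeGroup_of_signSymmetric`). `H` a polarizable `ℚ`-Hodge structure of odd
weight on `V ≠ 0`; `B` alternating non-degenerate on `V`, `σ² = 1` a `B`-isometry; `Γ ≤ GL(V)` whose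
identity component `glIdentityComponent Γ` lies in `MT(H)(ℚ)` (for the monodromy group of a smooth
projective family at a Hodge-generic point this is the tree's named fact
`deligne_finiteIndex_monodromy_le_mumfordTateGroup` (ii), `AlgebraicMonodromyMumfordTate.lean`); fixed
centres `T` and paired centres `D` with generators in `Γ`, spanning / orthogonally connected / seeded
eigen-sets `R_±` as in `mem_glZariskiClosure_of_signSymmetric`. Then for all `σ`-commuting `B`-isometries
`g, h`: `g h g⁻¹ h⁻¹ ∈ H.hodgeGroup` — the predicate `Comm` of route
`Summits/HodgeConjecture/HodgeConjecture/Theses/SignSymmetricPowers.lean` (cruxes K1/K2), modulo the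
GEOMETRIC inputs (Picard–Lefschetz generators of both node types, conjugacy of vanishing cycles per
discriminant component, the `B₂` link, spanning), which are the prover's.

## References

* [Deligne1980] P. Deligne, La conjecture de Weil : II, Publ. Math. IHÉS 52 (1980), §4.4 (4.4.1)–(4.4.4^α).
* [CarlsonMullerStachPeters2017] J. Carlson, S. Müller-Stach, C. Peters, Period Mappings and Period Domains,
  2nd ed. (2017), Lemma–Definition 15.3.7, Proposition 15.3.9, Corollary 15.3.10, Theorem 15.2.9.
* [Moonen2004MT] B. Moonen, An introduction to Mumford–Tate groups (2004), (5.8).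
-/

noncomputable section

open Literature.AlgebraicGeometry.Motives

namespace Literature.AlgebraicGeometry.HodgeTheory

universe u

variable {V : Type u} [AddCommGroup V] [Module ℚ V] [Module.Finite ℚ V] [HodgeTensorFacts.{u, u}] {n : ℤ}

/-- **Commutators of the sign-symmetric centraliser lie in `Hg(H)(ℚ)`** (Theorem A of memo ROUTE-P3v11
§3 + Deligne–André, algebraic skeleton): see the module docstring. [cite: Deligne1980, §4.4 Thm (4.4.1), (4.4.2^α)–(4.4.4^α) pp. 227–228]
[cite: CarlsonMullerStachPeters2017, Lemma–Definition 15.3.7 and Corollary 15.3.10] [cite: Moonen2004MT, (5.8)] -/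
theorem commutator_mem_hodgeGroup_of_signSymmetric [Nontrivial V] (H : HodgeStructure V n) (hH : H.IsPolarizable)
    (hn : Odd n) {B : LinearMap.BilinForm ℚ V} (hB : B.IsAlt) (hBn : B.Nondegenerate) {σ : V →ₗ[ℚ] V}
    (hσ : σ ^ 2 = 1) (hσB : ∀ x y, B (σ x) (σ y) = B x y) {Γ : Subgroup (V ≃ₗ[ℚ] V)}
    (hΓ : glIdentityComponent Γ ⊆ (H.mumfordTateGroup : Set (V ≃ₗ[ℚ] V))) {T D : Set V}
    (hT : ∀ r ∈ T, ∃ c : ℚ, c ≠ 0 ∧ oneParamTransvectionEquiv B (hB r) c ∈ Γ)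
    (hD : ∀ δ ∈ D, B δ (σ δ) = 0 ∧ ∃ c : ℚ, c ≠ 0 ∧
      oneParamTransvectionEquiv B (hB δ) c * oneParamTransvectionEquiv B (hB (σ δ)) c ∈ Γ)
    (hspanPos : Submodule.span ℚ ({r ∈ T | σ r = r} ∪ (fun δ => δ + σ δ) '' D) = Module.End.eigenspace σ 1)
    (hconnPos : ∀ A ⊆ {r ∈ T | σ r = r} ∪ (fun δ => δ + σ δ) '' D, A.Nonempty →
      A ≠ {r ∈ T | σ r = r} ∪ (fun δ => δ + σ δ) '' D →
      ∃ r ∈ A, ∃ ρ ∈ {r ∈ T | σ r = r} ∪ (fun δ => δ + σ δ) '' D, ρ ∉ A ∧ B r ρ ≠ 0)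
    (hseedPos : ({r ∈ T | σ r = r} ∪ (fun δ => δ + σ δ) '' D).Nonempty → ∃ r ∈ T, σ r = r)
    (hspanNeg : Submodule.span ℚ ({r ∈ T | σ r = -r} ∪ (fun δ => δ - σ δ) '' D) =
      Module.End.eigenspace σ (-1))
    (hconnNeg : ∀ A ⊆ {r ∈ T | σ r = -r} ∪ (fun δ => δ - σ δ) '' D, A.Nonempty →
      A ≠ {r ∈ T | σ r = -r} ∪ (fun δ => δ - σ δ) '' D →
      ∃ r ∈ A, ∃ ρ ∈ {r ∈ T | σ r = -r} ∪ (fun δ => δ - σ δ) '' D, ρ ∉ A ∧ B r ρ ≠ 0)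
    (hseedNeg : ({r ∈ T | σ r = -r} ∪ (fun δ => δ - σ δ) '' D).Nonempty → ∃ r ∈ T, σ r = -r)
    {g h : V ≃ₗ[ℚ] V} (hgσ : ∀ x, g (σ x) = σ (g x)) (hgB : ∀ x y, B (g x) (g y) = B x y)
    (hhσ : ∀ x, h (σ x) = σ (h x)) (hhB : ∀ x y, B (h x) (h y) = B x y) :
    g * h * g⁻¹ * h⁻¹ ∈ H.hodgeGroup :=
  commutator_mem_hodgeGroup_of_subset_mumfordTateGroup H hH hn hΓ
    (mem_glIdentityComponent_of_signSymmetric hB hBn hσ hσB hT hD hspanPos hconnPos hseedPos hspanNeg hconnNeg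
      hseedNeg hgσ hgB)
    (mem_glIdentityComponent_of_signSymmetric hB hBn hσ hσB hT hD hspanPos hconnPos hseedPos hspanNeg hconnNeg
      hseedNeg hhσ hhB)

/-- The same with the Zariski closure in place of the identity component: if `glZariskiClosure Γ ⊆ MT(H)(ℚ)`
(e.g. `Γ ≤ MT(H)(ℚ)`, by `glZariskiClosure_subset_mumfordTateGroup`), commutators of `σ`-commuting
`B`-isometries lie in `Hg(H)(ℚ)`. [cite: Deligne1980, §4.4 Thm (4.4.1), (4.4.2^α)–(4.4.4^α) pp. 227–228]
[cite: CarlsonMullerStachPeters2017, Lemma–Definition 15.3.7 and Theorem 15.2.9] [cite: Moonen2004MT, (5.8)] -/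
theorem commutator_mem_hodgeGroup_of_signSymmetric_of_glZariskiClosure_subset [Nontrivial V] (H : HodgeStructure V n)
    (hH : H.IsPolarizable) (hn : Odd n) {B : LinearMap.BilinForm ℚ V} (hB : B.IsAlt) (hBn : B.Nondegenerate)
    {σ : V →ₗ[ℚ] V} (hσ : σ ^ 2 = 1) (hσB : ∀ x y, B (σ x) (σ y) = B x y) {Γ : Subgroup (V ≃ₗ[ℚ] V)}
    (hΓ : glZariskiClosure Γ ⊆ (H.mumfordTateGroup : Set (V ≃ₗ[ℚ] V))) {T D : Set V}
    (hT : ∀ r ∈ T, ∃ c : ℚ, c ≠ 0 ∧ oneParamTransvectionEquiv B (hB r) c ∈ Γ)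
    (hD : ∀ δ ∈ D, B δ (σ δ) = 0 ∧ ∃ c : ℚ, c ≠ 0 ∧
      oneParamTransvectionEquiv B (hB δ) c * oneParamTransvectionEquiv B (hB (σ δ)) c ∈ Γ)
    (hspanPos : Submodule.span ℚ ({r ∈ T | σ r = r} ∪ (fun δ => δ + σ δ) '' D) = Module.End.eigenspace σ 1)
    (hconnPos : ∀ A ⊆ {r ∈ T | σ r = r} ∪ (fun δ => δ + σ δ) '' D, A.Nonempty →
      A ≠ {r ∈ T | σ r = r} ∪ (fun δ => δ + σ δ) '' D →
      ∃ r ∈ A, ∃ ρ ∈ {r ∈ T | σ r = r} ∪ (fun δ => δ + σ δ) '' D, ρ ∉ A ∧ B r ρ ≠ 0)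
    (hseedPos : ({r ∈ T | σ r = r} ∪ (fun δ => δ + σ δ) '' D).Nonempty → ∃ r ∈ T, σ r = r)
    (hspanNeg : Submodule.span ℚ ({r ∈ T | σ r = -r} ∪ (fun δ => δ - σ δ) '' D) =
      Module.End.eigenspace σ (-1))
    (hconnNeg : ∀ A ⊆ {r ∈ T | σ r = -r} ∪ (fun δ => δ - σ δ) '' D, A.Nonempty →
      A ≠ {r ∈ T | σ r = -r} ∪ (fun δ => δ - σ δ) '' D →
      ∃ r ∈ A, ∃ ρ ∈ {r ∈ T | σ r = -r} ∪ (fun δ => δ - σ δ) '' D, ρ ∉ A ∧ B r ρ ≠ 0)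
    (hseedNeg : ({r ∈ T | σ r = -r} ∪ (fun δ => δ - σ δ) '' D).Nonempty → ∃ r ∈ T, σ r = -r)
    {g h : V ≃ₗ[ℚ] V} (hgσ : ∀ x, g (σ x) = σ (g x)) (hgB : ∀ x y, B (g x) (g y) = B x y)
    (hhσ : ∀ x, h (σ x) = σ (h x)) (hhB : ∀ x y, B (h x) (h y) = B x y) :
    g * h * g⁻¹ * h⁻¹ ∈ H.hodgeGroup :=
  commutator_mem_hodgeGroup_of_subset_mumfordTateGroup H hH hn hΓ
    (mem_glZariskiClosure_of_signSymmetric hB hBn hσ hσB hT hD hspanPos hconnPos hseedPos hspanNeg hconnNeg hseedNeg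
      hgσ hgB)
    (mem_glZariskiClosure_of_signSymmetric hB hBn hσ hσB hT hD hspanPos hconnPos hseedPos hspanNeg hconnNeg hseedNeg
      hhσ hhB)

end Literature.AlgebraicGeometry.HodgeTheory
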